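import Summits.ValiantsHypothesis.ValiantsHypothesis.Theorems.DivisionGapZeroOneTransferSignedSpan
import Summits.ValiantsHypothesis.ValiantsHypothesis.Theorems.DivisionGapZeroOneTransferProjClosure
import Summits.ValiantsHypothesis.ValiantsHypothesis.Theorems.DivisionGapStDivisionEasy
import Summits.ValiantsHypothesis.ValiantsHypothesis.Theorems.ZeroOneTransfer.Negative.Faces
import Literature.Computability.AlgebraicComplexity.ArithCircuitProofs

/-!
# Route DivisionGap, crux `ZeroOneTransfer` (stmt-ValiantsHypothesis-5066), line `arborescence-span` —
# the REDUCTION: Kirchhoff sign elimination implies the crux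

`stub_spanReduction` (registered stub of the lead's skeleton): the finitary, purely combinatorial bet
of the line — KIRCHHOFF SIGN ELIMINATION (S2): "one constant `c` such that every 0/1-coefficient
polynomial with a signed representation `f · A + C = B` by positive projections of `ST_N`, `A ≠ 0`,
has an unsigned one `f · ΣA'_i = ΣB'_j` by positive projections of `ST_{N'}`, `ΣA' ≠ 0`,
`N', I, J ≤ 2^((log₂ N + c)^c)`" — IMPLIES the crux
`Summit.ValiantsHypothesis.ValiantsHypothesis.Theses.DivisionGap.ZeroOneTransfer`.

Everything else on the line is now a theorem of the tree, and this file composes it: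

* S1, the signed span (`stub_signedSpan`, `DivisionGapZeroOneTransferSignedSpan.lean`): every family
  over `ℝ≥0` whose complexification is in `VP_ℂ` has `f_n · A + C = B` over `ST_N`, `N` qp;
* S1 + S2 give the two-sided span `f_n · ΣA_i = ΣB_j` of quasi-polynomial size (`span_of_signElim`,
  quasi-polynomials compose: `exists_qp_absorb`);
* the span is division-easy: `StDivisionEasy` (`stDivisionEasy_proof`, FominGrigorievKoshevoy2014
  Thm 7.2 by star–mesh) bounds `divComplexity (stPoly ℝ≥0 N)` polynomially, `stub_projClosure`
  (`DivisionGapZeroOneTransferProjClosure.lean`) makes `divComplexity` projection-monotone (zero labels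
  included), and short sums / exact quotients of division-easy polynomials are division-easy
  (`divComplexity_sum_le`, `divComplexity_le_of_mul_eq`; common denominators, no cancellation over
  `ℝ≥0`) — `divComplexity_le_of_span`;
* the infimum `divComplexity f_n` (`Negative/Faces.lean`) is attained by an honest nonzero cofactor.

So the crux `ZeroOneTransfer` is reduced, inside the tree, to the single statement S2; by the
planner's finding S2 is in turn implied by `ZeroOneTransfer` strengthened with a quasi-polynomial
bound on the cofactor degree (padding lemma + monotone balancing), i.e. it is the crux in Kirchhoff
normal form.  No new definitions (`divComplexity` is the landed one of `Negative/Faces.lean`; the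
quasi-polynomial scale `2 ^ ((log₂ n + c) ^ c)` is a local notation).
-/

noncomputable section

-- Sub = Summit single-conjunct layout: the duplicated namespace component is mandated by the tree.
set_option linter.dupNamespace false

namespace Summit.ValiantsHypothesis.ValiantsHypothesis.Theorems.DivisionGapZeroOneTransfer

open Literature.Computability.AlgebraicComplexity Literature.Barriers.ValiantsHypothesis
open Summit.ValiantsHypothesis.ValiantsHypothesis.Theorems.ZeroOneTransfer.Negative (divComplexity
  divComplexity_le_of_ne_zero exists_eq_divComplexity)
open MvPolynomial Finset
open scoped NNReal

/-- `qpB[c, n]` (local notation, not a definition): the tree's quasi-polynomial scale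
`2 ^ ((log₂ n + c) ^ c)` of `IsQPBounded` and of the crux. -/
local notation3 "qpB[" c ", " n "]" => (2 ^ ((Nat.log 2 n + c) ^ c) : ℕ)

namespace SpanReduction

/-! ### Closure calculus of `divComplexity` over `ℝ≥0` -/

/-- **Quotient closure** (card lemma A2): if `f · a = b` with `a ≠ 0` then
`divComplexity f ≤ divComplexity a + divComplexity b + 2` — cofactor `a · h_a · h_b`, where `a h_a = g_a`, `b h_b = g_b` are
optimal certificates; no zero divisors and no cancellation over `ℝ≥0`. [folklore] -/
theorem divComplexity_le_of_mul_eq {σ : Type*} {f a b : MvPolynomial σ ℝ≥0} (ha : a ≠ 0)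
    (hab : f * a = b) : divComplexity f ≤ divComplexity a + divComplexity b + 2 := by
  obtain ⟨ha', hane, hae⟩ := exists_eq_divComplexity a
  obtain ⟨hb', hbne, hbe⟩ := exists_eq_divComplexity b
  have hH : a * ha' * hb' ≠ 0 := mul_ne_zero (mul_ne_zero ha hane) hbne
  have key : f * (a * ha' * hb') = b * hb' * ha' := by rw [← hab]; ring
  calc divComplexity f ≤ complexity (f * (a * ha' * hb')) + complexity (a * ha' * hb') := divComplexity_le_of_ne_zero f hH
    _ = complexity (b * hb' * ha') + complexity (a * ha' * hb') := by rw [key]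
    _ ≤ (complexity (b * hb') + complexity ha' + 1) + (complexity (a * ha') + complexity hb' + 1) :=
        add_le_add (complexity_mul_le_holds _ _) (complexity_mul_le_holds _ _)
    _ = divComplexity a + divComplexity b + 2 := by rw [← hae, ← hbe]; ring

/-- **Sum closure** (card lemma A3, quadratic form): a short sum of division-easy polynomials is
division-easy — common denominator `H = Π_j h_j`, numerator `Σ_j g_j Π_{i ≠ j} h_i`; the bound is
quadratic in the number of terms because the tree's `complexity` is per polynomial (shared factors
are recomputed), which is all the quasi-polynomial bookkeeping needs. [folklore] -/
theorem divComplexity_sum_le {σ ι : Type*} (s : Finset ι) (p : ι → MvPolynomial σ ℝ≥0) :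
    divComplexity (∑ j ∈ s, p j) ≤
      (2 * s.card + 1) * (∑ j ∈ s, divComplexity (p j)) + s.card ^ 2 + 3 * s.card := by
  classical
  choose h hne heq using fun j => exists_eq_divComplexity (p j)
  set D := ∑ j ∈ s, divComplexity (p j) with hD
  have hh1 : ∀ j, complexity (h j) ≤ divComplexity (p j) := fun j => by
    rw [← heq j]; exact Nat.le_add_left _ _
  have hg1 : ∀ j, complexity (p j * h j) ≤ divComplexity (p j) := fun j => by
    rw [← heq j]; exact Nat.le_add_right _ _
  have hdle : ∀ j ∈ s, divComplexity (p j) ≤ D := fun j hj =>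
    Finset.single_le_sum (fun i _ => Nat.zero_le (divComplexity (p i))) hj
  have hhsum : ∑ i ∈ s, complexity (h i) ≤ D := Finset.sum_le_sum fun i _ => hh1 i
  have hH : ∏ i ∈ s, h i ≠ 0 := Finset.prod_ne_zero_iff.mpr fun i _ => hne i
  have key : (∑ j ∈ s, p j) * ∏ i ∈ s, h i = ∑ j ∈ s, (p j * h j) * ∏ i ∈ s.erase j, h i := by
    rw [Finset.sum_mul]
    refine Finset.sum_congr rfl fun j hj => ?_
    rw [mul_assoc, Finset.mul_prod_erase s h hj]
  -- the denominator
  have hden : complexity (∏ i ∈ s, h i) ≤ D + s.card :=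
    (complexity_finset_prod_le _ _).trans (Nat.add_le_add_right hhsum _)
  -- the numerator, term by term
  have hterm : ∀ j ∈ s, complexity ((p j * h j) * ∏ i ∈ s.erase j, h i) ≤ 2 * D + s.card + 1 := by
    intro j hj
    have h1 : complexity (∏ i ∈ s.erase j, h i) ≤ D + s.card :=
      calc complexity (∏ i ∈ s.erase j, h i)
            ≤ ∑ i ∈ s.erase j, complexity (h i) + (s.erase j).card := complexity_finset_prod_le _ _
        _ ≤ ∑ i ∈ s, complexity (h i) + s.card :=
              add_le_add (Finset.sum_le_sum_of_subset (Finset.erase_subset j s))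
                (Finset.card_le_card (Finset.erase_subset j s))
        _ ≤ D + s.card := Nat.add_le_add_right hhsum _
    calc complexity ((p j * h j) * ∏ i ∈ s.erase j, h i)
          ≤ complexity (p j * h j) + complexity (∏ i ∈ s.erase j, h i) + 1 :=
            complexity_mul_le_holds _ _
      _ ≤ D + (D + s.card) + 1 := by
          gcongr
          exact (hg1 j).trans (hdle j hj)
      _ = 2 * D + s.card + 1 := by ring
  have hnum : complexity (∑ j ∈ s, (p j * h j) * ∏ i ∈ s.erase j, h i) ≤
      s.card * (2 * D + s.card + 1) + s.card :=
    calc complexity (∑ j ∈ s, (p j * h j) * ∏ i ∈ s.erase j, h i)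
          ≤ ∑ j ∈ s, complexity ((p j * h j) * ∏ i ∈ s.erase j, h i) + s.card :=
            complexity_finset_sum_le _ _
      _ ≤ s.card • (2 * D + s.card + 1) + s.card :=
            Nat.add_le_add_right (Finset.sum_le_card_nsmul _ _ _ hterm) _
      _ = s.card * (2 * D + s.card + 1) + s.card := by rw [smul_eq_mul]
  calc divComplexity (∑ j ∈ s, p j)
        ≤ complexity ((∑ j ∈ s, p j) * ∏ i ∈ s, h i) + complexity (∏ i ∈ s, h i) :=
          divComplexity_le_of_ne_zero _ hH
    _ = complexity (∑ j ∈ s, (p j * h j) * ∏ i ∈ s.erase j, h i) + complexity (∏ i ∈ s, h i) := by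
          rw [key]
    _ ≤ (s.card * (2 * D + s.card + 1) + s.card) + (D + s.card) := add_le_add hnum hden
    _ = (2 * s.card + 1) * D + s.card ^ 2 + 3 * s.card := by ring

/-! ### The quasi-polynomial scale -/

/-- `qpB` is monotone in `n`. [folklore] -/
theorem qpB_mono (c : ℕ) {n m : ℕ} (h : n ≤ m) : qpB[c, n] ≤ qpB[c, m] := by
  exact Nat.pow_le_pow_right two_pos
    (Nat.pow_le_pow_left (Nat.add_le_add_right (Nat.log_mono_right h) c) c)

/-- `log₂ (qpB[c, n]) = (log₂ n + c) ^ c`. [folklore] -/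
theorem log_qpB (c n : ℕ) : Nat.log 2 (qpB[c, n]) = (Nat.log 2 n + c) ^ c := by
  exact Nat.log_pow (by norm_num) _

/-- Quasi-polynomials absorb polynomials and compose: for all `c₁ c₂ a k` there is `c` with
`a · (qpB[c₂, qpB[c₁, n]]) ^ k ≤ qpB[c, n]` for every `n`. [folklore] -/
theorem exists_qp_absorb (c₁ c₂ a k : ℕ) :
    ∃ c : ℕ, ∀ n : ℕ, a * (qpB[c₂, qpB[c₁, n]]) ^ k ≤ qpB[c, n] := by
  set P := (c₁ + 1) * c₂ with hP
  refine ⟨a + k + P + c₁ + c₂ + 2, fun n => ?_⟩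
  set c := a + k + P + c₁ + c₂ + 2 with hc
  set L := Nat.log 2 n with hL
  set M := L + c with hM
  have hM1 : 1 ≤ M := by omega
  have hE : qpB[c₂, qpB[c₁, n]] = 2 ^ (((L + c₁) ^ c₁ + c₂) ^ c₂) := by
    show 2 ^ ((Nat.log 2 (qpB[c₁, n]) + c₂) ^ c₂) = _
    rw [log_qpB]
  have h1 : (L + c₁) ^ c₁ ≤ M ^ c₁ := Nat.pow_le_pow_left (by omega) _
  have hMc1 : 1 ≤ M ^ c₁ := Nat.one_le_pow _ _ hM1
  have h2 : (L + c₁) ^ c₁ + c₂ ≤ M ^ (c₁ + 1) :=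
    calc (L + c₁) ^ c₁ + c₂ ≤ M ^ c₁ + c₂ * M ^ c₁ := by nlinarith
      _ = (1 + c₂) * M ^ c₁ := by ring
      _ ≤ M * M ^ c₁ := Nat.mul_le_mul_right _ (by omega)
      _ = M ^ (c₁ + 1) := by ring
  have h3 : ((L + c₁) ^ c₁ + c₂) ^ c₂ ≤ M ^ P :=
    calc ((L + c₁) ^ c₁ + c₂) ^ c₂ ≤ (M ^ (c₁ + 1)) ^ c₂ := Nat.pow_le_pow_left h2 _
      _ = M ^ P := by rw [← pow_mul]
  have hP1 : 1 ≤ M ^ P := Nat.one_le_pow _ _ hM1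
  have h4 : a + k * ((L + c₁) ^ c₁ + c₂) ^ c₂ ≤ M ^ c :=
    calc a + k * ((L + c₁) ^ c₁ + c₂) ^ c₂ ≤ a * M ^ P + k * M ^ P := by
          have := Nat.mul_le_mul_left k h3
          nlinarith
      _ = (a + k) * M ^ P := by ring
      _ ≤ M * M ^ P := Nat.mul_le_mul_right _ (by omega)
      _ = M ^ (P + 1) := by ring
      _ ≤ M ^ c := Nat.pow_le_pow_right hM1 (by omega)
  calc a * (qpB[c₂, qpB[c₁, n]]) ^ k = a * 2 ^ (k * ((L + c₁) ^ c₁ + c₂) ^ c₂) := by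
        rw [hE, ← pow_mul, mul_comm (((L + c₁) ^ c₁ + c₂) ^ c₂) k]
    _ ≤ 2 ^ a * 2 ^ (k * ((L + c₁) ^ c₁ + c₂) ^ c₂) :=
        Nat.mul_le_mul_right _ (Nat.lt_two_pow_self).le
    _ = 2 ^ (a + k * ((L + c₁) ^ c₁ + c₂) ^ c₂) := by rw [← pow_add]
    _ ≤ 2 ^ (M ^ c) := Nat.pow_le_pow_right two_pos h4
    _ = qpB[c, n] := rfl

/-- The polynomial bookkeeping of `ZeroOneTransfer_of`: with `I, J ≤ X`, `1 ≤ X` and generator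
cost `X ^ c₃ + c₃`, the quotient-of-two-sums certificate costs at most `(6 c₃ + 18) · X ^ (c₃ + 2)`.
[folklore] -/
theorem arith_bound (c₃ X I J : ℕ) (hX : 1 ≤ X) (hI : I ≤ X) (hJ : J ≤ X) :
    ((2 * I + 1) * (I * (X ^ c₃ + c₃)) + I ^ 2 + 3 * I) +
      ((2 * J + 1) * (J * (X ^ c₃ + c₃)) + J ^ 2 + 3 * J) + 2 ≤ (6 * c₃ + 18) * X ^ (c₃ + 2) := by
  set P := X ^ c₃ with hP
  have hP1 : 1 ≤ P := Nat.one_le_pow _ _ hX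
  have hD : X ^ c₃ + c₃ ≤ (c₃ + 1) * P := by rw [← hP]; nlinarith
  have hpow : X ^ (c₃ + 2) = P * X ^ 2 := by rw [hP, ← pow_add]
  have hbr : ∀ K : ℕ, K ≤ X →
      (2 * K + 1) * (K * (X ^ c₃ + c₃)) + K ^ 2 + 3 * K ≤ (3 * c₃ + 7) * (P * X ^ 2) := by
    intro K hK
    have h1 : K * (X ^ c₃ + c₃) ≤ X * ((c₃ + 1) * P) := Nat.mul_le_mul hK hD
    have h2 : (2 * K + 1) * (K * (X ^ c₃ + c₃)) ≤ (3 * X) * (X * ((c₃ + 1) * P)) :=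
      Nat.mul_le_mul (by omega) h1
    have h3 : K ^ 2 + 3 * K ≤ 4 * X ^ 2 := by nlinarith
    have h4 : 4 * X ^ 2 ≤ 4 * (P * X ^ 2) := by nlinarith
    nlinarith
  have hI' := hbr I hI
  have hJ' := hbr J hJ
  have hX2 : 1 ≤ P * X ^ 2 := by nlinarith
  rw [hpow]
  nlinarith

/-! ### Division complexity of the generators -/

/-- `stub_projClosure` in terms of `divComplexity`: division complexity is projection-monotone over
`ℝ≥0`, zero labels included. [folklore] -/
theorem divComplexity_le_of_isProjection {ι τ : Type} {p : MvPolynomial ι ℝ≥0}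
    {q : MvPolynomial τ ℝ≥0} (hq : IsProjection q p) : divComplexity q ≤ divComplexity p := by
  obtain ⟨h, hne, heq⟩ := exists_eq_divComplexity p
  obtain ⟨h', hne', hle⟩ := stub_projClosure ι τ p q hq h hne
  exact (divComplexity_le_of_ne_zero q hne').trans (heq ▸ hle)

/-- The generator is division-easy: `divComplexity (ST_N) ≤ N ^ c + c`, from the route item
`StDivisionEasy` proved in the tree (`Summit.ValiantsHypothesis.DivisionGap.stDivisionEasy_proof`,
FominGrigorievKoshevoy2014 Thm 7.2 by star–mesh); the inline sum of the route file is `stPoly ℝ≥0 N`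
after unfolding `IsArborescence` and `parentMap`. [cite: FominGrigorievKoshevoy2014, Thm 7.2] -/
theorem divComplexity_stPoly_le : ∃ c : ℕ, ∀ N : ℕ, divComplexity (stPoly ℝ≥0 N) ≤ N ^ c + c := by
  obtain ⟨c, hc⟩ := Summit.ValiantsHypothesis.DivisionGap.stDivisionEasy_proof
  refine ⟨c, fun N => ?_⟩
  obtain ⟨h, hne, hle⟩ := hc N
  have key : complexity (stPoly ℝ≥0 N * h) + complexity h ≤ N ^ c + c := by
    convert hle using 4
    unfold stPoly IsArborescence parentMap
    apply Finset.sum_congr _ (fun _ _ => rfl)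
    ext t
    simp only [Finset.mem_filter]
  exact (divComplexity_le_of_ne_zero _ hne).trans key

/-! ### From a two-sided span to a division certificate -/

/-- **The span is division-easy.**  If `f · ΣA_i = ΣB_j` with `A_i, B_j` positive projections of
`ST_N`, `ΣA_i ≠ 0` and `N, I, J ≤ X = qpB[c₀, n]`, then `divComplexity f ≤ qpB[c, n]` for a `c`
depending only on `c₀` (and the exponent of `StDivisionEasy`): generators cost `≤ X^{c₃} + c₃`
(projection closure), the two sums and the quotient are closed (`divComplexity_sum_le`,
`divComplexity_le_of_mul_eq`, `arith_bound`), and one quasi-polynomial absorbs the polynomial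
overhead (`exists_qp_absorb`). [folklore] -/
theorem divComplexity_le_of_span (c₀ : ℕ) : ∃ c : ℕ, ∀ (n : ℕ) (τ : Type) (f : MvPolynomial τ ℝ≥0)
    (N I J : ℕ) (A : Fin I → MvPolynomial τ ℝ≥0) (B : Fin J → MvPolynomial τ ℝ≥0),
    N ≤ qpB[c₀, n] → I ≤ qpB[c₀, n] → J ≤ qpB[c₀, n] →
    (∀ i, IsProjection (A i) (stPoly ℝ≥0 N)) → (∀ j, IsProjection (B j) (stPoly ℝ≥0 N)) →
    (∑ i, A i) ≠ 0 → f * ∑ i, A i = ∑ j, B j → divComplexity f ≤ qpB[c, n] := by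
  classical
  obtain ⟨c₃, hc₃⟩ := divComplexity_stPoly_le
  obtain ⟨c, hc⟩ := exists_qp_absorb c₀ 1 (6 * c₃ + 18) (c₃ + 2)
  refine ⟨c, fun n τ f N I J A B hN hI hJ hA hB hA0 hEq => ?_⟩
  set X : ℕ := qpB[c₀, n] with hXdef
  have hX1 : 1 ≤ X := Nat.one_le_two_pow
  have hgen : ∀ q : MvPolynomial τ ℝ≥0, IsProjection q (stPoly ℝ≥0 N) →
      divComplexity q ≤ X ^ c₃ + c₃ := by
    intro q hq
    calc divComplexity q ≤ divComplexity (stPoly ℝ≥0 N) := divComplexity_le_of_isProjection hq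
      _ ≤ N ^ c₃ + c₃ := hc₃ N
      _ ≤ X ^ c₃ + c₃ := Nat.add_le_add_right (Nat.pow_le_pow_left hN _) _
  have hSA : divComplexity (∑ i, A i) ≤ (2 * I + 1) * (I * (X ^ c₃ + c₃)) + I ^ 2 + 3 * I := by
    have h := divComplexity_sum_le (Finset.univ : Finset (Fin I)) A
    rw [Finset.card_univ, Fintype.card_fin] at h
    refine h.trans ?_
    have hs : ∑ i, divComplexity (A i) ≤ I * (X ^ c₃ + c₃) := by
      calc ∑ i, divComplexity (A i) ≤ (Finset.univ : Finset (Fin I)).card • (X ^ c₃ + c₃) :=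
            Finset.sum_le_card_nsmul _ _ _ fun i _ => hgen _ (hA i)
        _ = I * (X ^ c₃ + c₃) := by rw [Finset.card_univ, Fintype.card_fin, smul_eq_mul]
    gcongr
  have hSB : divComplexity (∑ j, B j) ≤ (2 * J + 1) * (J * (X ^ c₃ + c₃)) + J ^ 2 + 3 * J := by
    have h := divComplexity_sum_le (Finset.univ : Finset (Fin J)) B
    rw [Finset.card_univ, Fintype.card_fin] at h
    refine h.trans ?_
    have hs : ∑ j, divComplexity (B j) ≤ J * (X ^ c₃ + c₃) := by
      calc ∑ j, divComplexity (B j) ≤ (Finset.univ : Finset (Fin J)).card • (X ^ c₃ + c₃) :=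
            Finset.sum_le_card_nsmul _ _ _ fun j _ => hgen _ (hB j)
        _ = J * (X ^ c₃ + c₃) := by rw [Finset.card_univ, Fintype.card_fin, smul_eq_mul]
    gcongr
  have hf : divComplexity f ≤ (6 * c₃ + 18) * X ^ (c₃ + 2) :=
    calc divComplexity f ≤ divComplexity (∑ i, A i) + divComplexity (∑ j, B j) + 2 :=
          divComplexity_le_of_mul_eq hA0 hEq
      _ ≤ ((2 * I + 1) * (I * (X ^ c₃ + c₃)) + I ^ 2 + 3 * I) +
            ((2 * J + 1) * (J * (X ^ c₃ + c₃)) + J ^ 2 + 3 * J) + 2 := by gcongr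
      _ ≤ (6 * c₃ + 18) * X ^ (c₃ + 2) := arith_bound c₃ X I J hX1 hI hJ
  have hXle : X ≤ qpB[1, qpB[c₀, n]] := by
    show X ≤ 2 ^ ((Nat.log 2 X + 1) ^ 1)
    rw [pow_one]
    exact (Nat.lt_pow_succ_log_self one_lt_two X).le
  exact hf.trans ((Nat.mul_le_mul_left _ (Nat.pow_le_pow_left hXle _)).trans (hc n))

end SpanReduction

open SpanReduction

/-! ### The stub: S2 implies the crux -/

/-- **Kirchhoff sign elimination implies `ZeroOneTransfer`** (registered stub `stub_spanReduction`
of the line `arborescence-span`).  Given S2 (the hypothesis, verbatim the registered bet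
`stub_signElimination`) and a 0/1 family `f` over `ℝ≥0` whose complexification is in `VP_ℂ`: S1
(`stub_signedSpan`) gives `f_n · A + C = B` over `ST_N`, `N ≤ qpB[c₁, n]`; S2 turns it into
`f_n · ΣA' = ΣB'` over `ST_{N'}` with `N', I, J ≤ qpB[c₂, N] ≤ qpB[c', n]` (`exists_qp_absorb`); the
span is division-easy (`divComplexity_le_of_span`); and `divComplexity f_n` is attained by a nonzero
cofactor (`exists_eq_divComplexity`). [folklore] -/
theorem stub_spanReduction :
    (∃ c : ℕ, ∀ (N : ℕ) (τ : Type) [Fintype τ] (f : MvPolynomial τ NNReal),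
      (∀ m, MvPolynomial.coeff m f = 0 ∨ MvPolynomial.coeff m f = 1) →
      ∀ A B C : MvPolynomial τ NNReal,
        Literature.Computability.AlgebraicComplexity.IsProjection A
            (Literature.Barriers.ValiantsHypothesis.stPoly NNReal N) →
        Literature.Computability.AlgebraicComplexity.IsProjection B
            (Literature.Barriers.ValiantsHypothesis.stPoly NNReal N) →
        Literature.Computability.AlgebraicComplexity.IsProjection C
            (Literature.Barriers.ValiantsHypothesis.stPoly NNReal N) →
        A ≠ 0 → f * A + C = B →
        ∃ N' ≤ 2 ^ ((Nat.log 2 N + c) ^ c), ∃ I ≤ 2 ^ ((Nat.log 2 N + c) ^ c),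
          ∃ J ≤ 2 ^ ((Nat.log 2 N + c) ^ c),
          ∃ (A' : Fin I → MvPolynomial τ NNReal) (B' : Fin J → MvPolynomial τ NNReal),
            (∀ i, Literature.Computability.AlgebraicComplexity.IsProjection (A' i)
                (Literature.Barriers.ValiantsHypothesis.stPoly NNReal N')) ∧
            (∀ j, Literature.Computability.AlgebraicComplexity.IsProjection (B' j)
                (Literature.Barriers.ValiantsHypothesis.stPoly NNReal N')) ∧
            (∑ i, A' i) ≠ 0 ∧ f * ∑ i, A' i = ∑ j, B' j) →
    Summit.ValiantsHypothesis.ValiantsHypothesis.Theses.DivisionGap.ZeroOneTransfer := by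
  rintro ⟨c₂, hc₂⟩ σ _ f h01 hVP
  classical
  obtain ⟨c₁, hc₁⟩ := stub_signedSpan σ f hVP
  obtain ⟨c', hc'⟩ := exists_qp_absorb c₁ c₂ 1 1
  obtain ⟨c, hc⟩ := divComplexity_le_of_span c'
  refine ⟨c, fun n => ?_⟩
  obtain ⟨N, hN, A, B, C, hA, hB, hC, hA0, hABC⟩ := hc₁ n
  obtain ⟨N', hN', I, hI, J, hJ, A', B', hA', hB', hA'0, hEq⟩ :=
    hc₂ N (σ n) (f n) (h01 n) A B C hA hB hC hA0 hABC
  have hX : qpB[c₂, N] ≤ qpB[c', n] := by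
    have h1 : qpB[c₂, N] ≤ qpB[c₂, qpB[c₁, n]] := qpB_mono c₂ hN
    have h2 := hc' n
    rw [one_mul, pow_one] at h2
    exact h1.trans h2
  have hdiv : divComplexity (f n) ≤ qpB[c, n] :=
    hc n (σ n) (f n) N' I J A' B' (hN'.trans hX) (hI.trans hX) (hJ.trans hX) hA' hB' hA'0 hEq
  obtain ⟨h, hne, heq⟩ := exists_eq_divComplexity (f n)
  exact ⟨h, hne, heq ▸ hdiv⟩

end Summit.ValiantsHypothesis.ValiantsHypothesis.Theorems.DivisionGapZeroOneTransfer

end
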